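import Mathlib
import Literature.MathematicalPhysics.QuantumFieldTheory.Balaban1983to89.B14Eq348ClassGeometry
import Literature.MathematicalPhysics.QuantumFieldTheory.Balaban1983to89.B14Eq363SummedKernel

/-!
# `Balaban1983to89.B14.Eq357KernelDecay` — T. Bałaban, *Convergent renormalization expansions for lattice gauge theories*,
# Commun. Math. Phys. **119** (1988) 243–285 [Balaban1988Convergent]: the whole-lattice three-point kernel
# `Π^{(j)}_{μν}(x, y, z)` of p. 281 (after (3.57)) — its product exponential decay `|Π^{(j)}_{μν}(x, y, z)| ≤
# C e^{−κ′|x−z|₁} e^{−κ′|y−z|₁}`, the standing hypothesis `B14.Eq364Beta.Decay3` of the (3.61)–(3.64) chain, DERIVED from the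
# localization expansion, the bound (I.1.18)/(3.48) and [II] (1.26) — with [II] (1.26) on the INFINITE lattice `L⁻ʲZ^d`

statement-level skeleton of published theorems with citation tags; proofs where landed; nothing here is a claim about the Yang–Mills mass gap

PDF held: `paper:balaban1988-cmp119-convergent-renormalization` (journal page = PDF page + 242); pp. 279–283 [PDF 37–41] re-read
as images on the x2 renders `…-p037-x2.png` … `…-p041-x2.png` of the cell `pub-balaban`.

CITATION HEADER (lean-in-tree rule).  WHAT IS REPRODUCED, verbatim.  [Balaban1988Convergent] p. 281: *"We sum up the
identities over all such domains, and we extend the sum on the right-hand side to all domains X ∈ 𝐃_j for the space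
L⁻ʲZ^d, X containing the point z. The difference between the two sums contributes to the irrelevant terms only, by the
bounds (3.48). … Here Π^{(j)}_{μν,κλ} = Σ_{x,y} Π^{(j)}_{μν}(x, y, z)(x_κ − z_κ)(y_λ − z_λ), and the function Π^{(j)}_{μν}(x, y, z)
is given by the formula (3.50), but with 𝐄^{(j)}(X, U_j, z) replaced by 𝐄^{(j)}(U_j, z) defined on the whole lattice L⁻ʲZ^d.
This function is translation invariant, hence Π^{(j)}_{μν,κλ} is independent of z."*; (3.50) p. 280: *"𝐄^{(2)}_{μν}(X, x, y,
z) = (δ²/δB_μ(x)δB_ν(y)) 𝐄^{(j)}(X, U_j(exp iB), z)|_{B=0}"*; (2.27) p. 259: *"𝐄^{(j)}(Λ_j, U_k, z) = Σ_{X∋z} 𝐄^{(j)}(X, U_k, z),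
(2.27) where the last sum is over localization domains X ∈ 𝐃_j contained in Λ_j, X ⊂ Λ_j. The term 𝐄^{(j)}(X, U_k, z) of the
last sum has the following properties: (i) it depends on U_k restricted to X"* (v1.1: quotation made verbatim; v1 abridged
it); (3.48) p. 280 / [Balaban1987RG1] (1.18) p. 261: *"|𝐄^{(j)}(X, U′U_k(X))| ≦ E₀ exp(−κd_j(X))"*.  [Balaban1988RG2Cluster] (= [II]) (1.26) p. 8: *"Σ_{X∈𝐃_j, X⊃□′} exp(−κd_j(X)) ≤ O(1),
(1.26) for κ sufficiently large."*

SKELETON rows (owner r11): **B14.Eq3.62–3.64**, **B14.Eq3.58–3.61**, **B14.Eq3.55–3.57** — the (3.61) ⇒ (3.64) chain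
`B14.Eq364Beta.eq364` / `B14.Eq363SummedKernel.eq364_summed` / `B14Eq360TensorInvariance` / `B14.Eq361Scalar` /
`B14Eq362Marginals` all carry the decay of the three-point kernel as the HYPOTHESIS `Decay3 P3 C κ` (`B14.Eq364Beta`:
*"displayed as the hypothesis actually used"*).  THIS FILE derives it.  THE MODEL (lattice units): the sites of `L⁻ʲZ^d` are
`Pt d = ℤ^d`; the cubes of π_j are the blocks of `M^d` sites, the cube of a site `x` has index `coarse M x = ⌊x/M⌋`
(`B13ScaleTransfer.coarse`); the localization domains `𝐃_j` of the INFINITE lattice are the non-empty finite face-connected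
families of cube indices (`LocDom d`), with `d_j := TreeLength.treeLen`; a LOCALIZED KERNEL FAMILY is `K X μ ν x y` =
`𝐄^{(2)}_{μν}(X, x, y, z)` (any fixed `z`, any `j`), (2.27)(i) locality read on the kernel: `K X μ ν x y ≠ 0 ⇒` the cubes of
`x` and `y` are cubes of `X` (hypothesis `hloc`), and (I.1.18) for the kernel: `|K X μ ν x y| ≤ E₂e^{−κd_j(X)}` (hypothesis `hbd`
— the printed (1.18) is for the function; its second `B`-derivative obeys the same decay with a Cauchy constant `E₂`, which
is the input displayed); the whole-lattice kernel is `threeKernel M K μ ν x y z := Σ'_{X ∈ 𝐃_j, X ∋ cube of z} K X μ ν x y`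
(*"(3.50) … with 𝐄^{(j)}(X, U_j, z) replaced by 𝐄^{(j)}(U_j, z)"*, the second derivative of the (2.27)-sum being the sum of the
second derivatives — carried as the DEFINITION of the series; (M1″)).
WHAT IS PROVED (no `sorry`; one `def` per object; nothing existing is modified):
* §1 **[II] (1.26) ON THE INFINITE LATTICE** `L⁻ʲZ^d`: `sum_expAbove_le` (every finite partial sum of `Σ_{X∈𝐃_j, X∋c}
  e^{−κd_j(X)}` is `≤ K₀(4·2^d, 2d)` for `κ ≥ κ₀(4·2^d, 2d)` — the window theorem `TreeLengthCubeSystem.sum_exp_treeLen_le` on the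
  window spanned by the finitely many domains), hence `summable_expAbove`, **`tsum_expAbove_le`** (the series converges
  unconditionally with sum `≤ K₀`; constants of `B12TreeDecay`, depending on `d` only);
* §2 site-versus-cube geometry: `abs_sub_le_of_coarse` (`|x_μ − z_μ| ≤ M(|⌊x/M⌋_μ − ⌊z/M⌋_μ| + 1)`), `l1_sub_le_treeLen`
  (`|x − z|₁ ≤ dM(d_j(X) + 2)` for sites `x`, `z` whose cubes are cubes of `X` — from the SHARP coordinate bound
  `B14.Eq348ClassGeometry.abs_sub_le_treeLen_add_one`), `decay_split` (the exponent bookkeeping `e^{−κd_j(X)} ≤ e^{4κ/3}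
  e^{−(κ/3)d_j(X)} e^{−κ′|x−z|₁} e^{−κ′|y−z|₁}`, `κ′ = κ/(3dM)`);
* §3 `threeKernel` and **`decay3_threeKernel`**: `Decay3 (threeKernel M K) (E₂·K₀(4·2^d,2d)·e^{4κ/3}) (κ/(3dM))` for
  `κ/3 ≥ κ₀(4·2^d, 2d)` — the hypothesis `hD` of `B14.Eq364Beta.eq364` DISCHARGED for every kernel arising this way; with it
  `summable_threeKernel_terms` (the defining series converge absolutely), and the consumers restated with `hD` discharged:
  `expBound_sumKernel_threeKernel` ((I.5.10)-type decay of the summed kernel (3.63), `B14.Eq363SummedKernel.expBound_sumKernel`)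
  and `eq364_threeKernel` (`β′_j = β_j`, `B14.Eq363SummedKernel.eq364_summed`, remaining inputs: translation invariance
  p. 281, the marginal identities (I.4.15)₁, [I]'s Taylor data (I.5.16)).
Model notes (declared).  (M1″) The whole-lattice kernel is DEFINED as the series of the per-domain kernels over `X ∋` cube
of `z` (print: the second derivative of `𝐄^{(j)}(U_j, z) = Σ_{X∋z}𝐄^{(j)}(X, U_j, z)`; term-by-term differentiation of the
localization series is not re-derived here).  (M2″) "z ∈ X", "x ∈ X" for sites and unions of closed cubes are carried by
cube indices `⌊·/M⌋ ∈ X` (corner-anchored blocks, `B14.Eq348ClassGeometry` (M1′)); bonds are carried by their sites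
(`B14.Eq350Kernel` §2 scalar components).  (M3″) (I.1.18) enters for the KERNEL with its own constant `E₂` (hypothesis
`hbd`); locality (2.27)(i) as `hloc`.  (M4″) free infinite lattice `ℤ^d` (no torus identification), as printed *"for the
space L⁻ʲZ^d"*.

Mega-formalization `lit-balaban`, unit `lit-balaban-r11` gen 6 (B14 fold owner), HOME `run/shared/lean/pub/lit-balaban/`.

## References
* [Balaban1988Convergent] T. Bałaban, Commun. Math. Phys. 119 (1988) 243–285, (2.27) p.259, (3.48) p.280, (3.50) p.280, p.281.
* [Balaban1987RG1] T. Bałaban, Commun. Math. Phys. 109 (1987) 249–301 ([I]: p.257, (1.18) p.261).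
* [Balaban1988RG2Cluster] T. Bałaban, Commun. Math. Phys. 116 (1988) 1–22 ([II]: (1.26) p.8).
-/

namespace Literature.MathematicalPhysics.QuantumFieldTheory.Balaban1983to89.B14.Eq357KernelDecay

noncomputable section

open Literature.MathematicalPhysics.QuantumFieldTheory.Balaban1983to89
open Literature.MathematicalPhysics.QuantumFieldTheory.Balaban1983to89.B13ScaleTransfer
open Literature.MathematicalPhysics.QuantumFieldTheory.Balaban1983to89.TreeLength
open Literature.MathematicalPhysics.QuantumFieldTheory.Balaban1983to89.TreeLengthCubeSystem
open Literature.MathematicalPhysics.QuantumFieldTheory.Balaban1983to89.B12TreeDecay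
open Literature.MathematicalPhysics.QuantumFieldTheory.Balaban1983to89.B14.Eq348ClassGeometry
open Literature.MathematicalPhysics.QuantumFieldTheory.Balaban1983to89.B14.Eq364Beta
open Literature.MathematicalPhysics.QuantumFieldTheory.GawedzkiKupiainen1985.PeriodicGleason (l1 wt wt_pos l1_nonneg ExpBound)
open Finset

variable {d : ℕ}

/-! ## §1. [II] (1.26) on the infinite lattice `L⁻ʲZ^d` -/

/-- **The localization domains `𝐃_j` of the infinite lattice** `L⁻ʲZ^d` ([Balaban1987RG1] p. 257: the unions of
*"a connected, finite family of cubes from π_j"*; p. 281 *"all domains X ∈ 𝐃_j for the space L⁻ʲZ^d"*): non-empty finite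
face-connected families of cube indices. [cite: Balaban1988Convergent, p.281 (domains of the space L^{-j}Z^d)] -/
def LocDom (d : ℕ) : Type := {X : Finset (Pt d) // X.Nonempty ∧ FaceConnected X}

/-- The general term of [II] (1.26) above the cube `c`: `e^{−κd_j(X)}` if `X ∋ c`, else `0`.
[cite: Balaban1988RG2Cluster, (1.26) p.8] -/
def expAbove (κ : ℝ) (c : Pt d) (X : LocDom d) : ℝ :=
  if c ∈ X.1 then Real.exp (-κ * treeLen X.1) else 0

/-- The general term of (1.26) is non-negative. [cite: Balaban1988RG2Cluster, (1.26) p.8] -/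
theorem expAbove_nonneg (κ : ℝ) (c : Pt d) (X : LocDom d) : 0 ≤ expAbove κ c X := by
  unfold expAbove
  split_ifs
  · exact (Real.exp_pos _).le
  · exact le_rfl

/-- **Every finite partial sum of (1.26) on the infinite lattice is `≤ K₀(4·2^d, 2d)`** for `κ ≥ κ₀(4·2^d, 2d)`: the finitely
many domains span a finite window `B`, on which `TreeLengthCubeSystem.sum_exp_treeLen_le` applies (its constant does not
depend on the window). [cite: Balaban1988RG2Cluster, (1.26) p.8] -/
theorem sum_expAbove_le {κ : ℝ} (hκ : kappa₀ (4 * 2 ^ d) (2 * d) ≤ κ) (c : Pt d) (F : Finset (LocDom d)) :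
    ∑ X ∈ F, expAbove κ c X ≤ K₀ (4 * 2 ^ d) (2 * d) := by
  classical
  set B : Finset (Pt d) := insert c (F.biUnion fun X => X.1) with hB
  have hc : c ∈ B := mem_insert_self _ _
  have key := sum_exp_treeLen_le B hc hκ
  have h1 : ∑ X ∈ F, expAbove κ c X = ∑ X ∈ F.filter (fun X => c ∈ X.1), Real.exp (-κ * treeLen X.1) := by
    rw [Finset.sum_filter]
    rfl
  have h2 : ∑ X ∈ F.filter (fun X => c ∈ X.1), Real.exp (-κ * treeLen X.1)
      = ∑ Y ∈ (F.filter (fun X => c ∈ X.1)).image (fun X => X.1), Real.exp (-κ * treeLen Y) := by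
    rw [Finset.sum_image]
    intro X _ Y _ h
    exact Subtype.ext h
  have h3 : (F.filter (fun X => c ∈ X.1)).image (fun X => X.1)
      ⊆ B.powerset.filter (fun X => c ∈ X ∧ FaceConnected X) := by
    intro Y hY
    obtain ⟨X, hX, rfl⟩ := mem_image.1 hY
    rw [mem_filter] at hX ⊢
    refine ⟨mem_powerset.2 ?_, hX.2, X.2.2⟩
    intro p hp
    exact mem_insert_of_mem (mem_biUnion.2 ⟨X, hX.1, hp⟩)
  rw [h1, h2]
  exact (sum_le_sum_of_subset_of_nonneg h3 fun _ _ _ => (Real.exp_pos _).le).trans key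

/-- (1.26) on the infinite lattice converges (unconditionally). [cite: Balaban1988RG2Cluster, (1.26) p.8] -/
theorem summable_expAbove {κ : ℝ} (hκ : kappa₀ (4 * 2 ^ d) (2 * d) ≤ κ) (c : Pt d) : Summable (expAbove κ c) :=
  summable_of_sum_le (expAbove_nonneg κ c) (sum_expAbove_le hκ c)

/-- **[II] (1.26) ON THE INFINITE LATTICE `L⁻ʲZ^d`**: `Σ_{X∈𝐃_j, X∋c} e^{−κd_j(X)} ≤ K₀(4·2^d, 2d)` for every cube `c` and
every `κ ≥ κ₀(4·2^d, 2d)`, `d_j = treeLen` (constants of `B12TreeDecay`, depending on `d` only).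
[cite: Balaban1988RG2Cluster, (1.26) p.8] -/
theorem tsum_expAbove_le {κ : ℝ} (hκ : kappa₀ (4 * 2 ^ d) (2 * d) ≤ κ) (c : Pt d) :
    ∑' X, expAbove κ c X ≤ K₀ (4 * 2 ^ d) (2 * d) :=
  (summable_expAbove hκ c).tsum_le_of_sum_le (sum_expAbove_le hκ c)

/-! ## §2. Sites versus cubes -/

/-- A site lies in its cube: `M⌊x/M⌋_μ ≤ x_μ < M⌊x/M⌋_μ + M`, so two sites are at most `M(|Δ cube index| + 1) − 1`
apart coordinatewise: `|x_μ − z_μ| ≤ M(|⌊x/M⌋_μ − ⌊z/M⌋_μ| + 1)`. [cite: Balaban1987RG1, p.257 (cubes of a size M)] -/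
theorem abs_sub_le_of_coarse {M : ℕ} (hM : 0 < M) (x z : Pt d) (i : Fin d) :
    |((x i : ℝ)) - z i| ≤ M * (|((coarse M x i : ℝ)) - coarse M z i| + 1) := by
  have hx := ((coarse_eq_iff hM x (coarse M x)).1 rfl i)
  have hz := ((coarse_eq_iff hM z (coarse M z)).1 rfl i)
  have hxr1 : ((M : ℤ) : ℝ) * (coarse M x i : ℝ) ≤ (x i : ℝ) := by exact_mod_cast hx.1
  have hxr2 : (x i : ℝ) < ((M : ℤ) : ℝ) * ((coarse M x i : ℝ) + 1) := by exact_mod_cast hx.2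
  have hzr1 : ((M : ℤ) : ℝ) * (coarse M z i : ℝ) ≤ (z i : ℝ) := by exact_mod_cast hz.1
  have hzr2 : (z i : ℝ) < ((M : ℤ) : ℝ) * ((coarse M z i : ℝ) + 1) := by exact_mod_cast hz.2
  have hMr : ((M : ℤ) : ℝ) = (M : ℝ) := by norm_cast
  rw [hMr] at hxr1 hxr2 hzr1 hzr2
  have hM0 : (0 : ℝ) ≤ M := by positivity
  rw [abs_le]
  constructor
  · have h := neg_abs_le (((coarse M x i : ℝ)) - coarse M z i)
    nlinarith
  · have h := le_abs_self (((coarse M x i : ℝ)) - coarse M z i)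
    nlinarith

/-- **`|x − z|₁ ≤ dM(d_j(X) + 2)`** for two sites whose cubes are cubes of the localization domain `X`: coordinatewise the
cube indices differ by at most `d_j(X) + 1` (`B14.Eq348ClassGeometry.abs_sub_le_treeLen_add_one`), the sites by at most
`M(d_j(X) + 2)`. [cite: Balaban1987RG1, p.257 (linear size d_j)] -/
theorem l1_sub_le_treeLen {M : ℕ} (hM : 0 < M) {X : Finset (Pt d)} (hX : X.Nonempty) (hc : FaceConnected X)
    {x z : Pt d} (hx : coarse M x ∈ X) (hz : coarse M z ∈ X) :
    l1 (x - z) ≤ d * M * (treeLen X + 2) := by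
  unfold GawedzkiKupiainen1985.PeriodicGleason.l1
  have h : ∀ i, |(((x - z) i : ℤ) : ℝ)| ≤ M * (treeLen X + 2) := fun i => by
    have h1 := abs_sub_le_of_coarse hM x z i
    have h2 := abs_sub_le_treeLen_add_one hX hc hx hz i
    have hM0 : (0 : ℝ) ≤ M := by positivity
    rw [Pi.sub_apply, Int.cast_sub]
    nlinarith
  calc ∑ i, |(((x - z) i : ℤ) : ℝ)| ≤ ∑ _i : Fin d, (M : ℝ) * (treeLen X + 2) := sum_le_sum fun i _ => h i
    _ = d * M * (treeLen X + 2) := by simp [mul_assoc]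

/-- **The exponent bookkeeping**: for sites `x`, `y`, `z` whose cubes are cubes of `X`,
`e^{−κd_j(X)} ≤ e^{4κ/3}·e^{−(κ/3)d_j(X)}·e^{−κ′|x−z|₁}·e^{−κ′|y−z|₁}` with `κ′ = κ/(3dM)` (`κ ≥ 0`; one third of the rate for
each of `x`, `y`, one third kept for the sum over `X`). [cite: Balaban1988Convergent, (3.48) p.280] -/
theorem decay_split {M : ℕ} (hM : 0 < M) {κ : ℝ} (hκ : 0 ≤ κ) {X : Finset (Pt d)} (hX : X.Nonempty)
    (hc : FaceConnected X) {x y z : Pt d} (hx : coarse M x ∈ X) (hy : coarse M y ∈ X) (hz : coarse M z ∈ X) :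
    Real.exp (-κ * treeLen X) ≤ Real.exp (4 * κ / 3) * Real.exp (-(κ / 3) * treeLen X)
      * wt (κ / (3 * d * M)) (x - z) * wt (κ / (3 * d * M)) (y - z) := by
  unfold GawedzkiKupiainen1985.PeriodicGleason.wt
  rw [← Real.exp_add, ← Real.exp_add, ← Real.exp_add]
  apply Real.exp_le_exp.2
  have hxz := l1_sub_le_treeLen hM hX hc hx hz
  have hyz := l1_sub_le_treeLen hM hX hc hy hz
  have ht := treeLen_nonneg X
  -- the key: κ/(3dM)·|v|₁ ≤ (κ/3)(d_j(X) + 2) for v = x − z, y − z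
  have key : ∀ {t : ℝ}, 0 ≤ t → t ≤ d * M * (treeLen X + 2) → κ / (3 * d * M) * t ≤ κ / 3 * (treeLen X + 2) := by
    intro t ht0 htb
    by_cases hdM : (d : ℝ) * M = 0
    · have : κ / (3 * d * M) = 0 := by
        rw [mul_assoc, hdM, mul_zero, div_zero]
      rw [this, zero_mul]
      exact mul_nonneg (by linarith) (by linarith)
    · have hd0 : (d : ℝ) ≠ 0 := fun h => hdM (by rw [h, zero_mul])
      have hM0 : (M : ℝ) ≠ 0 := fun h => hdM (by rw [h, mul_zero])
      calc κ / (3 * d * M) * t ≤ κ / (3 * d * M) * (d * M * (treeLen X + 2)) :=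
            mul_le_mul_of_nonneg_left htb (div_nonneg hκ (by positivity))
        _ = κ / 3 * (treeLen X + 2) := by field_simp
  have k1 := key (l1_nonneg _) hxz
  have k2 := key (l1_nonneg _) hyz
  nlinarith

/-! ## §3. The whole-lattice three-point kernel and its decay -/

/-- **The whole-lattice three-point kernel** `Π^{(j)}_{μν}(x, y, z)` (p. 281: *"given by the formula (3.50), but with
𝐄^{(j)}(X, U_j, z) replaced by 𝐄^{(j)}(U_j, z) defined on the whole lattice L⁻ʲZ^d"*, `𝐄^{(j)}(U_j, z) = Σ_{X∋z}𝐄^{(j)}(X,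
U_j, z)` by (2.27)) for a localized kernel family `K X μ ν x y = 𝐄^{(2)}_{μν}(X, x, y, z)`: the series over the localization
domains containing the cube of `z` (model note M1″). [cite: Balaban1988Convergent, p.281 (the function Π^{(j)}_{μν}(x,y,z))] -/
def threeKernel (M : ℕ) (K : Finset (Pt d) → Fin d → Fin d → Pt d → Pt d → ℝ) :
    Fin d → Fin d → Pt d → Pt d → Pt d → ℝ :=
  fun μ ν x y z => ∑' X : LocDom d, if coarse M z ∈ X.1 then K X.1 μ ν x y else 0

variable {M : ℕ} {K : Finset (Pt d) → Fin d → Fin d → Pt d → Pt d → ℝ} {E₂ κ : ℝ}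

/-- **Termwise majorant**: under locality (2.27)(i) (`hloc`) and the kernel bound (I.1.18) (`hbd`), every term of the
series defining `Π^{(j)}_{μν}(x, y, z)` is bounded by `E₂e^{4κ/3}e^{−κ′|x−z|₁}e^{−κ′|y−z|₁}` times the (1.26)-term at rate
`κ/3` above the cube of `z`. [cite: Balaban1988Convergent, (3.48) p.280] -/
theorem abs_term_le (hM : 0 < M) (hE₂ : 0 ≤ E₂) (hκ : 0 ≤ κ)
    (hloc : ∀ X μ ν x y, K X μ ν x y ≠ 0 → coarse M x ∈ X ∧ coarse M y ∈ X)
    (hbd : ∀ X : LocDom d, ∀ μ ν x y, |K X.1 μ ν x y| ≤ E₂ * Real.exp (-κ * treeLen X.1))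
    (μ ν : Fin d) (x y z : Pt d) (X : LocDom d) :
    |(if coarse M z ∈ X.1 then K X.1 μ ν x y else 0)|
      ≤ E₂ * Real.exp (4 * κ / 3) * wt (κ / (3 * d * M)) (x - z) * wt (κ / (3 * d * M)) (y - z)
        * expAbove (κ / 3) (coarse M z) X := by
  have hW : 0 ≤ E₂ * Real.exp (4 * κ / 3) * wt (κ / (3 * d * M)) (x - z) * wt (κ / (3 * d * M)) (y - z) :=
    mul_nonneg (mul_nonneg (mul_nonneg hE₂ (Real.exp_pos _).le) (wt_pos _ _).le) (wt_pos _ _).le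
  unfold expAbove
  split_ifs with hz
  · by_cases hK : K X.1 μ ν x y = 0
    · rw [hK, abs_zero]
      exact mul_nonneg hW (Real.exp_pos _).le
    · obtain ⟨hx, hy⟩ := hloc X.1 μ ν x y hK
      have h1 := hbd X μ ν x y
      have h2 := decay_split hM hκ X.2.1 X.2.2 hx hy hz
      calc |K X.1 μ ν x y| ≤ E₂ * Real.exp (-κ * treeLen X.1) := h1
        _ ≤ E₂ * (Real.exp (4 * κ / 3) * Real.exp (-(κ / 3) * treeLen X.1)
              * wt (κ / (3 * d * M)) (x - z) * wt (κ / (3 * d * M)) (y - z)) := mul_le_mul_of_nonneg_left h2 hE₂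
        _ = E₂ * Real.exp (4 * κ / 3) * wt (κ / (3 * d * M)) (x - z) * wt (κ / (3 * d * M)) (y - z)
              * Real.exp (-(κ / 3) * treeLen X.1) := by ring
  · rw [abs_zero, mul_zero]

/-- The series defining `Π^{(j)}_{μν}(x, y, z)` converges absolutely (for `κ/3 ≥ κ₀(4·2^d, 2d)`).
[cite: Balaban1988Convergent, p.281 (the function Π^{(j)}_{μν}(x,y,z))] -/
theorem summable_threeKernel_terms (hM : 0 < M) (hE₂ : 0 ≤ E₂) (hκ : kappa₀ (4 * 2 ^ d) (2 * d) ≤ κ / 3)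
    (hκ0 : 0 ≤ κ) (hloc : ∀ X μ ν x y, K X μ ν x y ≠ 0 → coarse M x ∈ X ∧ coarse M y ∈ X)
    (hbd : ∀ X : LocDom d, ∀ μ ν x y, |K X.1 μ ν x y| ≤ E₂ * Real.exp (-κ * treeLen X.1))
    (μ ν : Fin d) (x y z : Pt d) :
    Summable fun X : LocDom d => if coarse M z ∈ X.1 then K X.1 μ ν x y else 0 := by
  refine Summable.of_norm_bounded (g := fun X => E₂ * Real.exp (4 * κ / 3) * wt (κ / (3 * d * M)) (x - z)
    * wt (κ / (3 * d * M)) (y - z) * expAbove (κ / 3) (coarse M z) X) ?_ fun X => ?_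
  · exact (summable_expAbove hκ (coarse M z)).mul_left _
  · rw [Real.norm_eq_abs]
    exact abs_term_le hM hE₂ hκ0 hloc hbd μ ν x y z X

/-- **`Decay3` DERIVED** — the standing hypothesis of the (3.61)–(3.64) chain: for a three-point kernel arising from a
localization expansion with locality (2.27)(i) and the kernel bound (I.1.18) (`E₂`, rate `κ`, `κ/3 ≥ κ₀(4·2^d, 2d)`),
`|Π^{(j)}_{μν}(x, y, z)| ≤ E₂K₀(4·2^d, 2d)e^{4κ/3} · e^{−κ′|x−z|₁}e^{−κ′|y−z|₁}` with `κ′ = κ/(3dM)` — i.e.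
`B14.Eq364Beta.Decay3 (threeKernel M K) (E₂K₀e^{4κ/3}) (κ/(3dM))`: (3.48) termwise, the site/cube geometry of §2 and [II]
(1.26) on the infinite lattice (§1). [cite: Balaban1988Convergent, (3.48) p.280, p.281 (the function Π^{(j)}_{μν}(x,y,z))] -/
theorem decay3_threeKernel (hM : 0 < M) (hE₂ : 0 ≤ E₂) (hκ : kappa₀ (4 * 2 ^ d) (2 * d) ≤ κ / 3) (hκ0 : 0 ≤ κ)
    (hloc : ∀ X μ ν x y, K X μ ν x y ≠ 0 → coarse M x ∈ X ∧ coarse M y ∈ X)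
    (hbd : ∀ X : LocDom d, ∀ μ ν x y, |K X.1 μ ν x y| ≤ E₂ * Real.exp (-κ * treeLen X.1)) :
    Decay3 (threeKernel M K) (E₂ * K₀ (4 * 2 ^ d) (2 * d) * Real.exp (4 * κ / 3)) (κ / (3 * d * M)) := by
  intro μ ν x y z
  set W : ℝ := E₂ * Real.exp (4 * κ / 3) * wt (κ / (3 * d * M)) (x - z) * wt (κ / (3 * d * M)) (y - z) with hWdef
  have hW : 0 ≤ W := mul_nonneg (mul_nonneg (mul_nonneg hE₂ (Real.exp_pos _).le) (wt_pos _ _).le) (wt_pos _ _).le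
  have hs := summable_threeKernel_terms hM hE₂ hκ hκ0 hloc hbd μ ν x y z
  have hg : Summable fun X : LocDom d => W * expAbove (κ / 3) (coarse M z) X :=
    (summable_expAbove hκ (coarse M z)).mul_left W
  have hterm : ∀ X : LocDom d, ‖(if coarse M z ∈ X.1 then K X.1 μ ν x y else 0)‖
      ≤ W * expAbove (κ / 3) (coarse M z) X := fun X => by
    rw [Real.norm_eq_abs]
    exact abs_term_le hM hE₂ hκ0 hloc hbd μ ν x y z X
  unfold threeKernel
  calc |∑' X : LocDom d, (if coarse M z ∈ X.1 then K X.1 μ ν x y else 0)|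
      = ‖∑' X : LocDom d, (if coarse M z ∈ X.1 then K X.1 μ ν x y else 0)‖ := (Real.norm_eq_abs _).symm
    _ ≤ ∑' X : LocDom d, W * expAbove (κ / 3) (coarse M z) X := tsum_of_norm_bounded hg.hasSum hterm
    _ = W * ∑' X : LocDom d, expAbove (κ / 3) (coarse M z) X := tsum_mul_left
    _ ≤ W * K₀ (4 * 2 ^ d) (2 * d) := mul_le_mul_of_nonneg_left (tsum_expAbove_le hκ (coarse M z)) hW
    _ = E₂ * K₀ (4 * 2 ^ d) (2 * d) * Real.exp (4 * κ / 3) * wt (κ / (3 * d * M)) (x - z)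
          * wt (κ / (3 * d * M)) (y - z) := by rw [hWdef]; ring

/-- The rate `κ′ = κ/(3dM)` is positive when `κ > 0`, `d ≥ 1`. [folklore] -/
private theorem rate_pos (hM : 0 < M) (hd : 0 < d) (hκ : 0 < κ) : 0 < κ / (3 * d * M) := by
  have : (0 : ℝ) < 3 * d * M := by positivity
  exact div_pos hκ this

/-- **(I.5.10)-type decay of the summed kernel (3.63), `Decay3` discharged**: the `z`-summed kernel `Π_{μν}(v) = Σ_z Π_{μν}(v,
0, z)` of `B14.Eq363SummedKernel` decays exponentially at rate `κ′/2`, `κ′ = κ/(3dM)` — `B14.Eq363SummedKernel.expBound_sumKernel`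
fed with `decay3_threeKernel`. [cite: Balaban1988Convergent, (3.63) p.282] -/
theorem expBound_sumKernel_threeKernel (hM : 0 < M) (hd : 0 < d) (hE₂ : 0 ≤ E₂)
    (hκ : kappa₀ (4 * 2 ^ d) (2 * d) ≤ κ / 3) (hκ0 : 0 < κ)
    (hloc : ∀ X μ ν x y, K X μ ν x y ≠ 0 → coarse M x ∈ X ∧ coarse M y ∈ X)
    (hbd : ∀ X : LocDom d, ∀ μ ν x y, |K X.1 μ ν x y| ≤ E₂ * Real.exp (-κ * treeLen X.1)) (μ ν : Fin d) :
    ExpBound (κ / (3 * d * M) / 2)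
      ((E₂ * K₀ (4 * 2 ^ d) (2 * d) * Real.exp (4 * κ / 3)) * ∑' z : Pt d, wt (κ / (3 * d * M) / 2) z)
      (B12Rep537.ofReal (Eq363SummedKernel.sumKernel (threeKernel M K) μ ν)) :=
  Eq363SummedKernel.expBound_sumKernel (decay3_threeKernel hM hE₂ hκ hκ0.le hloc hbd) (rate_pos hM hd hκ0) μ ν

/-- **(3.64) `β′_j = β_j` with `Decay3` DISCHARGED** (`B14.Eq363SummedKernel.eq364_summed` fed with `decay3_threeKernel`):
for the whole-lattice kernel of a localization expansion with (2.27)(i) and (I.1.18), the remaining inputs are exactly the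
printed ones — translation invariance (p. 281), the marginal identities from (I.4.15)₁ (p. 282), and [I]'s Taylor data
(I.5.16) for the summed kernel. [cite: Balaban1988Convergent, (3.64) p.283] -/
theorem eq364_threeKernel (hM : 0 < M) (hd : 0 < d) (hE₂ : 0 ≤ E₂) (hκ : kappa₀ (4 * 2 ^ d) (2 * d) ≤ κ / 3)
    (hκ0 : 0 < κ) (hloc : ∀ X μ ν x y, K X μ ν x y ≠ 0 → coarse M x ∈ X ∧ coarse M y ∈ X)
    (hbd : ∀ X : LocDom d, ∀ μ ν x y, |K X.1 μ ν x y| ≤ E₂ * Real.exp (-κ * treeLen X.1))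
    (hT : TranslInv (threeKernel M K)) {one two : Fin d} (h12 : two ≠ one)
    (hWx : ∀ y, ∑' x, threeKernel M K two two x y 0 = 0) (hWy : ∀ x, ∑' y, threeKernel M K two two x y 0 = 0)
    {β : ℝ} (hTD : ∀ μ ν, B12Rep537.TaylorData3 (β : ℂ) μ ν
      (B12Form543.ofRealK (Eq363SummedKernel.sumKernel (threeKernel M K)) μ ν)) :
    betaPrime (threeKernel M K) one two = β :=
  Eq363SummedKernel.eq364_summed hT (decay3_threeKernel hM hE₂ hκ hκ0.le hloc hbd) (rate_pos hM hd hκ0) h12 hWx hWy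
    hTD

end

end Literature.MathematicalPhysics.QuantumFieldTheory.Balaban1983to89.B14.Eq357KernelDecay
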